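import Literature.Probability.LatticeModels.PlanarIsingOnePointProofs
import HarnessLib

/-!
# CHI Theorem 1.3 for all `k`, I: existence of the limits from `T₀`, Prop. 2.20 and Lemma 2.26

Companion to `PlanarIsingOnePoint.lean` and `PlanarIsingOnePointProofs.lean`, towards the named
fact `Literature.Probability.LatticeModels.chi_multiPoint_rho` (Chelkak–Hongler–Izyurov,
*Conformal invariance of spin correlations in the planar Ising model*, Ann. of Math. 181 (2015)
1087–1138 = arXiv:1202.2838 (CHI), Thm 1.3 for all `k`; numbering of the arXiv version).

CHI prove Theorem 1.3 by the induction `T₁ & L₁ ⇒ T₀ ⇒ L₂ ⇒ T₂ ⇒ ⋯` (§2.10, p. 20): for distinct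
`a, a₁, …, a_k ∈ Ω` and an auxiliary point `c` close to `∂Ω`,
`ϱ^{-(k+1)/2} 𝔼⁺[σ_aσ_{a₁}⋯σ_{a_k}] = [𝔼⁺[σ_aσ_A] / 𝔼⁺[σ_cσ_A]] · [𝔼⁺[σ_cσ_A] / (𝔼⁺[σ_c] 𝔼⁺[σ_A])] ·
  ϱ^{-1/2}𝔼⁺[σ_c] · ϱ^{-k/2}𝔼⁺[σ_A]`,
"take `c` close to the boundary, estimate the second term by Lemma 2.26, then use convergence of
the first and the third terms (which follows by Proposition 2.20 and induction hypothesis)".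
This file formalises that induction for the **existence** of the limits, sorry-free, inside one
admissible domain whose discretisations approximate it (`MeshApproximates Ω`), from three
hypotheses — CHI's published intermediate results in the tree's vocabulary, stated as predicates
of the domain and used **only as binders** (their printed proofs rest on the convergence of
discrete spinor observables, CHI Thm 1.5, Thm 1.7, §3, which the tree does not have):

* `CHIOnePointLimits Ω` — `T₀`: `ϱ(δ)^{-1/2} 𝔼⁺_{Ω_δ}[σ_a]` has a positive limit (a consequence of
  the named fact `chi_onePoint_rho`, CHI Thm 1.3 for `k = 0`);
* `CHIRatioLimits Ω` — CHI Prop 2.20: ratios of `(k+1)`-point correlations at distinct points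
  have positive limits;
* `CHIBoundaryDecorrelation Ω` — CHI Lemma 2.26, lower bound (the upper bound is GKS II, proved
  here: `meshIsingPlusCorr_one_mul_le_cons`).

Main result: `exists_pos_tendsto_rhoNormCorr` — for all distinct `a₁, …, aₙ ∈ Ω`,
`ϱ(δ)^{-n/2} 𝔼⁺_{Ω_δ}[σ_{a₁}⋯σ_{aₙ}]` has a positive limit as `δ → 0⁺`. Everything else is proved:
the abstract squeeze with unknown limit (`exists_pos_tendsto_of_squeeze`: for every `η` the
quantity is eventually pinched between `u` and `(1-η)⁻¹u` with `u` convergent, hence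
`limsup ≤ (1-η)⁻¹ liminf` and the limit exists — so CHI's identification of the limit through the
continuum decorrelation (2.23)/Lemma 2.22 is not needed for existence), GKS I/II for tuples
(`meshIsingPlusCorr_nonneg`, `meshIsingPlusCorr_one_mul_le_cons`, from `gks_one_holds`,
`gks_two_holds`), eventual freeness and distinctness of the rounded marked points, the existence
of auxiliary points near `∂Ω` (`exists_mem_notMem_infDist_lt`), and the pinching algebra
(`eventually_pinch_rhoNormCorr_cons`). The covariance rule (1.2) for the limits and the assembly of
`chi_multiPoint_rho` follow in `PlanarIsingMultiPointCovariance.lean`.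

## References

* D. Chelkak, C. Hongler, K. Izyurov, *Conformal invariance of spin correlations in the planar
  Ising model*, Ann. of Math. (2) 181 (2015), 1087–1138; arXiv:1202.2838: Thm 1.3, Prop 2.20,
  Lemma 2.26, §2.10 (proof of Thm 1.3, p. 20).
* S. Friedli, Y. Velenik, *Statistical Mechanics of Lattice Systems*, CUP (2017), Thm 3.20
  (GKS inequalities).
-/

noncomputable section

open MeasureTheory Filter Topology Real Metric Set
open Literature.Probability.LatticeModels
open scoped symmDiff

namespace Literature.Probability.LatticeModels

/-! ### The squeeze of CHI p. 20 with an unknown limit -/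

/-- **The squeeze of CHI's proof of Thm 1.3, abstract form with unknown limit** (CHI §2.10,
p. 20): if for every `η ∈ (0, 1/2]` the quantity `X` is eventually pinched between `u` and
`(1 - η)⁻¹ u` for some `u` converging to a positive limit, then `X` converges to a positive
limit. (CHI apply this with `u` = (ratio of correlations) × (lower-order normalised
correlations), whose limit is known by Prop 2.20 and the induction hypothesis, and the pinching
given by GKS/FKG and Lemma 2.26.) [cite: ChelkakHonglerIzyurovAnnals2015, §2.10, proof of Thm. 1.3] -/
theorem exists_pos_tendsto_of_squeeze {l : Filter ℝ} [l.NeBot] {X : ℝ → ℝ}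
    (h : ∀ η : ℝ, 0 < η → η ≤ 1 / 2 → ∃ (u : ℝ → ℝ) (ℓ : ℝ), 0 < ℓ ∧ Tendsto u l (𝓝 ℓ) ∧
      ∀ᶠ δ in l, u δ ≤ X δ ∧ X δ ≤ (1 - η)⁻¹ * u δ) :
    ∃ G : ℝ, 0 < G ∧ Tendsto X l (𝓝 G) := by
  obtain ⟨u₀, ℓ₀, hℓ₀, hu₀, hX₀⟩ := h (1 / 2) (by norm_num) le_rfl
  -- eventual two-sided bounds from `η = 1/2`
  have hlow : ∀ᶠ δ in l, ℓ₀ / 2 ≤ X δ := by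
    filter_upwards [hX₀, hu₀.eventually (lt_mem_nhds (show ℓ₀ / 2 < ℓ₀ by linarith))]
      with δ h1 h2
    exact h2.le.trans h1.1
  have hup : ∀ᶠ δ in l, X δ ≤ 2 * (ℓ₀ + 1) := by
    filter_upwards [hX₀, hu₀.eventually (gt_mem_nhds (show ℓ₀ < ℓ₀ + 1 by linarith))]
      with δ h1 h2
    have h3 : (1 - 1 / 2 : ℝ)⁻¹ = 2 := by norm_num
    have h4 := h1.2
    rw [h3] at h4
    linarith
  have hbdd : IsBoundedUnder (· ≤ ·) l X := ⟨_, hup⟩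
  have hbdd' : IsBoundedUnder (· ≥ ·) l X := ⟨_, hlow⟩
  -- for each `η`: `ℓ_η ≤ liminf X` and `limsup X ≤ (1 - η)⁻¹ ℓ_η`
  have key : ∀ η : ℝ, 0 < η → η ≤ 1 / 2 →
      ∃ ℓ : ℝ, 0 < ℓ ∧ ℓ ≤ liminf X l ∧ limsup X l ≤ (1 - η)⁻¹ * ℓ := by
    intro η hη hη2
    obtain ⟨u, ℓ, hℓ, hu, hX⟩ := h η hη hη2
    refine ⟨ℓ, hℓ, ?_, ?_⟩
    · rw [← hu.liminf_eq]
      exact liminf_le_liminf (hX.mono fun δ hδ => hδ.1) hu.isBoundedUnder_ge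
        hbdd.isCoboundedUnder_ge
    · have hu' : Tendsto (fun δ => (1 - η)⁻¹ * u δ) l (𝓝 ((1 - η)⁻¹ * ℓ)) := hu.const_mul _
      rw [← hu'.limsup_eq]
      exact limsup_le_limsup (hX.mono fun δ hδ => hδ.2) hbdd'.isCoboundedUnder_le
        hu'.isBoundedUnder_le
  obtain ⟨ℓ₁, hℓ₁, hℓ₁inf, -⟩ := key (1 / 2) (by norm_num) le_rfl
  set L := liminf X l with hL
  have hLpos : 0 < L := hℓ₁.trans_le hℓ₁inf
  -- `limsup X ≤ (1 - η)⁻¹ liminf X` for all small `η`, hence `limsup X ≤ liminf X`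
  have hsup_le : ∀ η : ℝ, 0 < η → η ≤ 1 / 2 → limsup X l ≤ (1 - η)⁻¹ * L := by
    intro η hη hη2
    obtain ⟨ℓ, -, hℓinf, hℓsup⟩ := key η hη hη2
    have h1 : 0 ≤ (1 - η)⁻¹ := inv_nonneg.2 (by linarith)
    exact hℓsup.trans (mul_le_mul_of_nonneg_left hℓinf h1)
  have hle : limsup X l ≤ L := by
    have hcont : Tendsto (fun η : ℝ => (1 - η)⁻¹ * L) (𝓝[>] 0) (𝓝 ((1 - 0)⁻¹ * L)) := by
      refine tendsto_nhdsWithin_of_tendsto_nhds ?_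
      exact ((tendsto_const_nhds.sub tendsto_id).inv₀ (by norm_num)).mul tendsto_const_nhds
    rw [sub_zero, inv_one, one_mul] at hcont
    refine ge_of_tendsto hcont ?_
    filter_upwards [Ioc_mem_nhdsGT (show (0 : ℝ) < 1 / 2 by norm_num)] with η hη
    exact hsup_le η hη.1 hη.2
  exact ⟨L, hLpos, tendsto_of_le_liminf_of_limsup_le le_rfl hle hbdd hbdd'⟩

/-- The bounds retained from one pinching: if `X → G`, `u → ℓ` and eventually
`u ≤ X ≤ (1 - η)⁻¹ u`, then `ℓ ≤ G ≤ (1 - η)⁻¹ ℓ`. [folklore] -/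
theorem le_and_le_of_squeeze {l : Filter ℝ} [l.NeBot] {X u : ℝ → ℝ} {G ℓ η : ℝ}
    (hX : Tendsto X l (𝓝 G)) (hu : Tendsto u l (𝓝 ℓ))
    (h : ∀ᶠ δ in l, u δ ≤ X δ ∧ X δ ≤ (1 - η)⁻¹ * u δ) : ℓ ≤ G ∧ G ≤ (1 - η)⁻¹ * ℓ :=
  ⟨le_of_tendsto_of_tendsto hu hX (h.mono fun _ h => h.1),
    le_of_tendsto_of_tendsto hX (hu.const_mul _) (h.mono fun _ h => h.2)⟩

/-! ### Lattice input for tuples: spin monomials as spin products, GKS I/II, free marked sites -/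

section Lattice

/-- The spin monomial of an injective tuple of sites is the spin product of its image
(`σ_x² = 1` is not even needed). [folklore] -/
theorem spinMonomial_eq_spinProduct_image {V : Type*} [DecidableEq V] {n : ℕ} {x : Fin n → V}
    (hx : Function.Injective x) : spinMonomial x = spinProduct (Finset.univ.image x) := by
  funext s
  unfold spinMonomial spinProduct
  rw [Finset.prod_image fun i _ j _ h => hx h]

/-- `𝔼⁺_{Ω_δ}[σ_{a₁} ⋯ σ_{aₙ}]` is the set-indexed correlation of the rounded sites when these are
distinct. [folklore] -/
theorem meshIsingPlusCorr_eq_isingCorr_image {n : ℕ} (Ω : Set ℂ) (δ : ℝ) {a : Fin n → ℂ}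
    (h : Function.Injective fun i => nearestSite δ (a i)) :
    meshIsingPlusCorr Ω δ a =
      isingCorr (discreteDomainGraph Ω δ) (meshInteriorFinset Ω δ) criticalBetaTwo 0 .plus
        (Finset.univ.image fun i => nearestSite δ (a i)) := by
  unfold meshIsingPlusCorr isingCorr
  rw [spinMonomial_eq_spinProduct_image h]

/-- `𝔼⁺_{Ω_δ}[σ_c σ_{a₁} ⋯ σ_{aₙ}]` is the set-indexed correlation of `{[c/δ]} ∆ {[aᵢ/δ]}` when the
rounded sites of the `aᵢ` are distinct and differ from `[c/δ]` (`σ_A σ_B = σ_{A ∆ B}`). [folklore] -/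
theorem meshIsingPlusCorr_cons_eq_isingCorr_symmDiff {n : ℕ} (Ω : Set ℂ) (δ : ℝ) {c : ℂ}
    {A : Fin n → ℂ} (hA : Function.Injective fun i => nearestSite δ (A i)) :
    meshIsingPlusCorr Ω δ (Matrix.vecCons c A) =
      isingCorr (discreteDomainGraph Ω δ) (meshInteriorFinset Ω δ) criticalBetaTwo 0 .plus
        ({nearestSite δ c} ∆ Finset.univ.image fun i => nearestSite δ (A i)) := by
  unfold meshIsingPlusCorr isingCorr
  congr 1
  funext s
  rw [← spinProduct_mul_eq_spinProduct_symmDiff, ← spinMonomial_eq_spinProduct_image hA]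
  simp [spinMonomial, spinProduct, Fin.prod_univ_succ]

/-- **GKS I for the CHI correlations**: `0 ≤ 𝔼⁺_{Ω_δ}[σ_{a₁} ⋯ σ_{aₙ}]` once the rounded sites are
distinct free sites. [cite: FriedliVelenik2017, Thm. 3.20, eq. (3.21)] -/
theorem meshIsingPlusCorr_nonneg {Ω : Set ℂ} {δ : ℝ} {n : ℕ} {a : Fin n → ℂ}
    (ha : ∀ i, nearestSite δ (a i) ∈ meshInteriorFinset Ω δ)
    (hinj : Function.Injective fun i => nearestSite δ (a i)) : 0 ≤ meshIsingPlusCorr Ω δ a := by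
  rw [meshIsingPlusCorr_eq_isingCorr_image Ω δ hinj]
  refine GKSInequalities.gks_one_holds (discreteDomainGraph Ω δ) criticalBetaTwo_pos.le le_rfl
    (Or.inr rfl) ?_
  intro x hx
  obtain ⟨i, -, rfl⟩ := Finset.mem_image.1 hx
  exact ha i

/-- **GKS II for the CHI correlations** (the upper bound of CHI Lemma 2.26, which CHI attribute
to FKG): `𝔼⁺_{Ω_δ}[σ_c] · 𝔼⁺_{Ω_δ}[σ_{a₁} ⋯ σ_{aₙ}] ≤ 𝔼⁺_{Ω_δ}[σ_c σ_{a₁} ⋯ σ_{aₙ}]` once all rounded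
sites are free, those of the `aᵢ` distinct and different from `[c/δ]`.
[cite: FriedliVelenik2017, Thm. 3.20, eq. (3.22)] -/
theorem meshIsingPlusCorr_one_mul_le_cons {Ω : Set ℂ} {δ : ℝ} {n : ℕ} {c : ℂ} {A : Fin n → ℂ}
    (hc : nearestSite δ c ∈ meshInteriorFinset Ω δ)
    (hA : ∀ i, nearestSite δ (A i) ∈ meshInteriorFinset Ω δ)
    (hinj : Function.Injective fun i => nearestSite δ (A i)) :
    meshIsingPlusCorr Ω δ ![c] * meshIsingPlusCorr Ω δ A ≤
      meshIsingPlusCorr Ω δ (Matrix.vecCons c A) := by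
  rw [meshIsingPlusCorr_one_eq, meshIsingPlusCorr_eq_isingCorr_image Ω δ hinj,
    meshIsingPlusCorr_cons_eq_isingCorr_symmDiff Ω δ hinj]
  refine GKSInequalities.gks_two_holds (discreteDomainGraph Ω δ) criticalBetaTwo_pos.le le_rfl
    (Or.inr rfl) (Finset.singleton_subset_iff.2 hc) ?_
  intro x hx
  obtain ⟨i, -, rfl⟩ := Finset.mem_image.1 hx
  exact hA i

/-- The empty correlation is `1`: `𝔼⁺_{Ω_δ}[1] = 1`. [folklore] -/
theorem meshIsingPlusCorr_fin_zero (Ω : Set ℂ) (δ : ℝ) (a : Fin 0 → ℂ) :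
    meshIsingPlusCorr Ω δ a = 1 := by
  unfold meshIsingPlusCorr
  simp [spinMonomial, isingExpect]

/-- All marked points of a tuple in `Ω` are eventually free sites (bulk clause of
`MeshApproximates`). [cite: ChelkakHonglerIzyurovAnnals2015, §2.1] -/
theorem eventually_forall_nearestSite_mem {Ω : Set ℂ} (hM : MeshApproximates Ω) {n : ℕ}
    {a : Fin n → ℂ} (ha : ∀ i, a i ∈ Ω) :
    ∀ᶠ δ in 𝓝[>] (0 : ℝ), ∀ i, nearestSite δ (a i) ∈ meshInteriorFinset Ω δ :=
  eventually_all.2 fun i => eventually_nearestSite_mem_meshInteriorFinset hM (ha i)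

/-- Distinct marked points eventually round to distinct sites. [folklore] -/
theorem eventually_nearestSite_injective {n : ℕ} {a : Fin n → ℂ} (ha : Function.Injective a) :
    ∀ᶠ δ in 𝓝[>] (0 : ℝ), Function.Injective fun i => nearestSite δ (a i) := by
  have h : ∀ᶠ δ in 𝓝[>] (0 : ℝ), ∀ i j, i ≠ j → nearestSite δ (a i) ≠ nearestSite δ (a j) := by
    refine eventually_all.2 fun i => eventually_all.2 fun j => ?_
    by_cases hij : i = j
    · exact Eventually.of_forall fun δ h => absurd hij h
    · exact (eventually_nearestSite_ne (ha.ne hij)).mono fun δ h _ => h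
  filter_upwards [h] with δ hδ i j hij
  by_contra hne
  exact hδ i j hne hij

end Lattice

/-! ### Points of `Ω` near `∂Ω` -/

/-- An admissible domain has points arbitrarily close to its complement avoiding any finite set:
`∂Ω ≠ ∅` (a bounded open set is not all of `ℂ`, and `ℂ` is connected), and a ball about a
boundary point meets `Ω` in an infinite set. [folklore] -/
theorem exists_mem_notMem_infDist_lt {Ω : Set ℂ} (hΩ : IsAdmissibleDomain Ω) {F : Set ℂ}
    (hF : F.Finite) {ε : ℝ} (hε : 0 < ε) :
    ∃ c ∈ Ω, c ∉ F ∧ Metric.infDist c Ωᶜ < ε := by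
  obtain ⟨hopen, hbdd, hne, -⟩ := hΩ
  have hU : Ω ≠ univ := by
    rintro rfl
    exact NormedSpace.unbounded_univ ℂ ℂ hbdd
  -- a boundary point
  have hfr : (frontier Ω).Nonempty := by
    by_contra h
    rw [Set.not_nonempty_iff_eq_empty, ← isClopen_iff_frontier_eq_empty, isClopen_iff] at h
    rcases h with h | h
    · exact hne.ne_empty h
    · exact hU h
  obtain ⟨p, hp⟩ := hfr
  have hpΩ : p ∈ Ωᶜ := fun hpΩ => ((hopen.frontier_eq ▸ hp).2 hpΩ).elim
  have hpcl : p ∈ closure Ω := frontier_subset_closure hp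
  -- a point of `Ω` in the ball about `p`, then infinitely many
  obtain ⟨q, hqΩ, hq⟩ := Metric.mem_closure_iff.1 hpcl ε hε
  have hopenU : IsOpen (Metric.ball p ε ∩ Ω) := Metric.isOpen_ball.inter hopen
  have hinf : (Metric.ball p ε ∩ Ω).Infinite :=
    infinite_of_mem_nhds q (hopenU.mem_nhds ⟨Metric.mem_ball'.2 hq, hqΩ⟩)
  obtain ⟨c, ⟨hcB, hcΩ⟩, hcF⟩ := (hinf.sdiff hF).nonempty
  refine ⟨c, hcΩ, hcF, ?_⟩
  calc Metric.infDist c Ωᶜ ≤ dist c p := Metric.infDist_le_dist_of_mem hpΩ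
    _ < ε := Metric.mem_ball.1 hcB

/-! ### CHI's ingredients as hypothesis predicates, and the normalised correlations -/

/-- CHI's `ϱ`-normalised discrete correlation `ϱ(δ)^{-n/2} · 𝔼⁺_{Ω_δ}[σ_{a₁} ⋯ σ_{aₙ}]`, the
quantity whose `δ → 0⁺` limit Theorem 1.3 asserts. [cite: ChelkakHonglerIzyurovAnnals2015, Thm. 1.3] -/
def rhoNormCorr {n : ℕ} (Ω : Set ℂ) (δ : ℝ) (a : Fin n → ℂ) : ℝ :=
  rhoCHI δ ^ (-(n : ℝ) / 2) * meshIsingPlusCorr Ω δ a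

/-- Unfolding `rhoNormCorr`. [cite: ChelkakHonglerIzyurovAnnals2015, Thm. 1.3] -/
theorem rhoNormCorr_def {n : ℕ} (Ω : Set ℂ) (δ : ℝ) (a : Fin n → ℂ) :
    rhoNormCorr Ω δ a = rhoCHI δ ^ (-(n : ℝ) / 2) * meshIsingPlusCorr Ω δ a := rfl

/-- **Hypothesis predicate — CHI Proposition 2.20 in the domain `Ω`** (eq. (2.20); the printed
limit is `⟨σ_{b_0} ⋯ σ_{b_k}⟩⁺_Ω / ⟨σ_{a_0} ⋯ σ_{a_k}⟩⁺_Ω`, the exponential of a real line integral,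
hence positive; only existence and positivity of the limit are recorded): for any two
`(k+1)`-tuples of distinct points of `Ω`, the ratio
`𝔼⁺_{Ω_δ}[σ_{b_0} ⋯ σ_{b_k}] / 𝔼⁺_{Ω_δ}[σ_{a_0} ⋯ σ_{a_k}]` has a positive limit as `δ → 0⁺`.
Used below only as a binder (its printed proof is the convergence of discrete spinor
observables, CHI Thm 1.5 / §3, not in the tree). [cite: ChelkakHonglerIzyurovAnnals2015, Prop. 2.20] -/
def CHIRatioLimits (Ω : Set ℂ) : Prop :=
  ∀ (n : ℕ) (a b : Fin (n + 1) → ℂ), Function.Injective a → Function.Injective b →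
    (∀ i, a i ∈ Ω) → (∀ i, b i ∈ Ω) →
      ∃ r : ℝ, 0 < r ∧
        Tendsto (fun δ => meshIsingPlusCorr Ω δ b / meshIsingPlusCorr Ω δ a) (𝓝[>] 0) (𝓝 r)

/-- **Hypothesis predicate — CHI Lemma 2.26 in the domain `Ω`, lower bound** ("given a domain
`Ω` with marked points `a₁, …, a_k` and `η > 0`, there is `ε > 0` such that if `a ∈ Ω` is
`ε`-close to the boundary and `Ω_δ` approximates `Ω`, then
`1 - η ≤ 𝔼⁺[σ_a] 𝔼⁺[σ_{a₁} ⋯ σ_{a_k}] / 𝔼⁺[σ_a σ_{a₁} ⋯ σ_{a_k}] ≤ 1`"; the lower bound multiplied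
out, for all small `δ`; the upper bound is GKS II, `meshIsingPlusCorr_one_mul_le_cons`). Used below
only as a binder (its printed proof uses GHS, FKG, CHI Thm 1.7 and Thm 1.3 for fewer points).
[cite: ChelkakHonglerIzyurovAnnals2015, Lemma 2.26] -/
def CHIBoundaryDecorrelation (Ω : Set ℂ) : Prop :=
  ∀ (n : ℕ) (A : Fin (n + 1) → ℂ), Function.Injective A → (∀ i, A i ∈ Ω) → ∀ η : ℝ, 0 < η →
    ∃ ε : ℝ, 0 < ε ∧ ∀ c ∈ Ω, Metric.infDist c Ωᶜ < ε → ∀ᶠ δ in 𝓝[>] (0 : ℝ),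
      (1 - η) * meshIsingPlusCorr Ω δ (Matrix.vecCons c A) ≤
        meshIsingPlusCorr Ω δ ![c] * meshIsingPlusCorr Ω δ A

/-- **Hypothesis predicate — CHI Theorem 1.3 for `k = 0` in the domain `Ω`, existence form**
(`T₀` in CHI's induction): the normalised magnetisation `ϱ(δ)^{-1/2} 𝔼⁺_{Ω_δ}[σ_a]` has a
positive limit for every `a ∈ Ω`. A consequence of the named fact `chi_onePoint_rho` (whose limit
`2^{1/4} |φ'(a)|^{1/8} (2 Im φ a)^{-1/8}` is positive). [cite: ChelkakHonglerIzyurovAnnals2015, Thm. 1.3 (k = 0)] -/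
def CHIOnePointLimits (Ω : Set ℂ) : Prop :=
  ∀ a ∈ Ω, ∃ G : ℝ, 0 < G ∧
    Tendsto (fun δ => rhoCHI δ ^ (-(1 : ℝ) / 2) * meshIsingPlusCorr Ω δ ![a]) (𝓝[>] 0) (𝓝 G)

/-! ### The pinching of CHI §2.10 (p. 20) -/

section Pinching

variable {Ω : Set ℂ}

/-- From `0 < ϱ(δ)^{-1/2} 𝔼⁺[σ_c]`: `𝔼⁺[σ_c] > 0` and `ϱ(δ) > 0`. [folklore] -/
theorem pos_of_rhoNorm_one_pos {δ : ℝ} {c : ℂ}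
    (h : 0 < rhoCHI δ ^ (-(1 : ℝ) / 2) * meshIsingPlusCorr Ω δ ![c]) :
    0 < meshIsingPlusCorr Ω δ ![c] ∧ 0 < rhoCHI δ := by
  have hρ := rhoCHI_nonneg δ
  have hE : 0 < meshIsingPlusCorr Ω δ ![c] := pos_of_mul_pos_right h (Real.rpow_nonneg hρ _)
  refine ⟨hE, lt_of_le_of_ne hρ fun h0 => ?_⟩
  rw [← h0, Real.zero_rpow (by norm_num)] at h
  simp at h

/-- CHI's comparison product in the proof of Theorem 1.3 (§2.10, p. 20, second display without
its middle factor):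
`[𝔼⁺[σ_aσ_{a₁}⋯σ_{a_k}] / 𝔼⁺[σ_cσ_{a₁}⋯σ_{a_k}]] · ϱ^{-1/2}𝔼⁺[σ_c] · ϱ^{-k/2}𝔼⁺[σ_{a₁}⋯σ_{a_k}]`.
[cite: ChelkakHonglerIzyurovAnnals2015, §2.10, proof of Thm. 1.3] -/
def rhoNormComparison {n : ℕ} (Ω : Set ℂ) (a c : ℂ) (A : Fin n → ℂ) (δ : ℝ) : ℝ :=
  meshIsingPlusCorr Ω δ (Matrix.vecCons a A) / meshIsingPlusCorr Ω δ (Matrix.vecCons c A) *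
    (rhoCHI δ ^ (-(1 : ℝ) / 2) * meshIsingPlusCorr Ω δ ![c]) * rhoNormCorr Ω δ A

/-- The comparison product converges to the product of the three limits (Prop 2.20, `T₀`,
induction hypothesis). [cite: ChelkakHonglerIzyurovAnnals2015, §2.10, proof of Thm. 1.3] -/
theorem tendsto_rhoNormComparison {n : ℕ} {a c : ℂ} {A : Fin n → ℂ} {r G₁ GA : ℝ}
    (hR : Tendsto (fun δ => meshIsingPlusCorr Ω δ (Matrix.vecCons a A) /
      meshIsingPlusCorr Ω δ (Matrix.vecCons c A)) (𝓝[>] 0) (𝓝 r))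
    (hX₁ : Tendsto (fun δ => rhoCHI δ ^ (-(1 : ℝ) / 2) * meshIsingPlusCorr Ω δ ![c]) (𝓝[>] 0)
      (𝓝 G₁))
    (hXA : Tendsto (fun δ => rhoNormCorr Ω δ A) (𝓝[>] 0) (𝓝 GA)) :
    Tendsto (rhoNormComparison Ω a c A) (𝓝[>] 0) (𝓝 (r * G₁ * GA)) :=
  (hR.mul hX₁).mul hXA

/-- **The pinching in CHI's proof of Theorem 1.3** (§2.10, p. 20): for distinct
`a, a₁, …, a_k ∈ Ω` and an auxiliary `c ∈ Ω` off the `aᵢ`, once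
`(1 - η) 𝔼⁺[σ_cσ_{a₁}⋯σ_{a_k}] ≤ 𝔼⁺[σ_c] 𝔼⁺[σ_{a₁}⋯σ_{a_k}]` holds for small `δ` (Lemma 2.26) and the
normalised `𝔼⁺[σ_c]`, `𝔼⁺[σ_{a₁}⋯σ_{a_k}]` have positive limits, the normalised
`(k+1)`-point function `X = ϱ^{-(k+1)/2} 𝔼⁺[σ_aσ_{a₁}⋯σ_{a_k}]` is eventually pinched,
`u ≤ X ≤ (1 - η)⁻¹ u`, by the comparison product `u` (`rhoNormComparison`): indeed
`X = K · 𝔼⁺[σ_cσ_A]` and `u = K · 𝔼⁺[σ_c]𝔼⁺[σ_A]` with `K ≥ 0` (GKS I), and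
`𝔼⁺[σ_c]𝔼⁺[σ_A] ≤ 𝔼⁺[σ_cσ_A]` (GKS II). [cite: ChelkakHonglerIzyurovAnnals2015, §2.10, proof of Thm. 1.3] -/
theorem eventually_pinch_rhoNormCorr_cons (hM : MeshApproximates Ω) {n : ℕ} {A : Fin (n + 1) → ℂ}
    (hA : Function.Injective A) (hAΩ : ∀ i, A i ∈ Ω) {a c : ℂ} (ha : a ∈ Ω) (hc : c ∈ Ω)
    (haA : ∀ i, a ≠ A i) (hcA : ∀ i, c ≠ A i) {G₁ GA η : ℝ} (hG₁ : 0 < G₁) (hGA : 0 < GA)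
    (hη : η < 1)
    (hX₁ : Tendsto (fun δ => rhoCHI δ ^ (-(1 : ℝ) / 2) * meshIsingPlusCorr Ω δ ![c]) (𝓝[>] 0)
      (𝓝 G₁))
    (hXA : Tendsto (fun δ => rhoNormCorr Ω δ A) (𝓝[>] 0) (𝓝 GA))
    (hLc : ∀ᶠ δ in 𝓝[>] (0 : ℝ), (1 - η) * meshIsingPlusCorr Ω δ (Matrix.vecCons c A) ≤
      meshIsingPlusCorr Ω δ ![c] * meshIsingPlusCorr Ω δ A) :
    ∀ᶠ δ in 𝓝[>] (0 : ℝ), rhoNormComparison Ω a c A δ ≤ rhoNormCorr Ω δ (Matrix.vecCons a A) ∧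
      rhoNormCorr Ω δ (Matrix.vecCons a A) ≤ (1 - η)⁻¹ * rhoNormComparison Ω a c A δ := by
  have hinj_a : Function.Injective (Matrix.vecCons a A) :=
    Fin.cons_injective_iff.2 ⟨fun ⟨i, hi⟩ => haA i hi.symm, hA⟩
  have hinj_c : Function.Injective (Matrix.vecCons c A) :=
    Fin.cons_injective_iff.2 ⟨fun ⟨i, hi⟩ => hcA i hi.symm, hA⟩
  have hmem_a : ∀ i, Matrix.vecCons a A i ∈ Ω := fun i => Fin.cases ha hAΩ i
  have hmem_c : ∀ i, Matrix.vecCons c A i ∈ Ω := fun i => Fin.cases hc hAΩ i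
  filter_upwards [hX₁.eventually_const_lt hG₁, hXA.eventually_const_lt hGA, hLc,
    eventually_forall_nearestSite_mem hM hmem_a, eventually_forall_nearestSite_mem hM hmem_c,
    eventually_nearestSite_injective hinj_a, eventually_nearestSite_injective hinj_c]
    with δ h1 h2 hLδ hfree_a hfree_c hinjδ_a hinjδ_c
  -- positivity of the pieces
  obtain ⟨hE1, hρ⟩ := pos_of_rhoNorm_one_pos h1
  have hρ0 : 0 ≤ rhoCHI δ := hρ.le
  have hEA : 0 < meshIsingPlusCorr Ω δ A :=
    pos_of_mul_pos_right (show 0 < rhoNormCorr Ω δ A from h2) (Real.rpow_nonneg hρ0 _)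
  have htail : Function.Injective fun i => nearestSite δ (A i) := fun i j h =>
    Fin.succ_injective _ (hinjδ_c (by simpa using h))
  have hgks2 : meshIsingPlusCorr Ω δ ![c] * meshIsingPlusCorr Ω δ A ≤
      meshIsingPlusCorr Ω δ (Matrix.vecCons c A) :=
    meshIsingPlusCorr_one_mul_le_cons (by simpa using hfree_c 0)
      (fun i => by simpa using hfree_c i.succ) htail
  have hEc : 0 < meshIsingPlusCorr Ω δ (Matrix.vecCons c A) := (mul_pos hE1 hEA).trans_le hgks2
  have hEa : 0 ≤ meshIsingPlusCorr Ω δ (Matrix.vecCons a A) :=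
    meshIsingPlusCorr_nonneg hfree_a hinjδ_a
  -- the algebra: `X = K · 𝔼[σ_cσ_A]`, `u = K · 𝔼[σ_c] 𝔼[σ_A]` with `K ≥ 0`
  set Ea := meshIsingPlusCorr Ω δ (Matrix.vecCons a A) with hEa_def
  set Ec := meshIsingPlusCorr Ω δ (Matrix.vecCons c A) with hEc_def
  set E1 := meshIsingPlusCorr Ω δ ![c] with hE1_def
  set EA := meshIsingPlusCorr Ω δ A with hEA_def
  set K := Ea / Ec * rhoCHI δ ^ (-(1 : ℝ) / 2) * rhoCHI δ ^ (-((n + 1 : ℕ) : ℝ) / 2) with hK_def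
  have hK : 0 ≤ K := by positivity
  have hρN : rhoCHI δ ^ (-((n + 1 + 1 : ℕ) : ℝ) / 2) =
      rhoCHI δ ^ (-(1 : ℝ) / 2) * rhoCHI δ ^ (-((n + 1 : ℕ) : ℝ) / 2) := by
    rw [← Real.rpow_add hρ]
    congr 1
    push_cast
    ring
  have hXeq : rhoNormCorr Ω δ (Matrix.vecCons a A) = K * Ec := by
    rw [rhoNormCorr_def, hρN, hK_def, ← hEa_def]
    field_simp
  have hueq : rhoNormComparison Ω a c A δ = K * (E1 * EA) := by
    rw [rhoNormComparison, rhoNormCorr_def, hK_def]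
    ring
  rw [hueq, hXeq]
  constructor
  · exact mul_le_mul_of_nonneg_left hgks2 hK
  · calc K * Ec ≤ K * ((1 - η)⁻¹ * (E1 * EA)) := by
          refine mul_le_mul_of_nonneg_left ?_ hK
          rw [le_inv_mul_iff₀ (by linarith : (0 : ℝ) < 1 - η)]
          exact hLδ
      _ = (1 - η)⁻¹ * (K * (E1 * EA)) := by ring

end Pinching

/-! ### The induction of CHI §2.10: existence of the limits for all `k` -/

section Convergence

variable {Ω : Set ℂ}

/-- **The induction step of CHI's proof of Theorem 1.3** (§2.10, p. 20, second display): for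
distinct `a, a₁, …, a_k ∈ Ω` (`k ≥ 1`) write, with an auxiliary point `c` close to `∂Ω`,
`ϱ^{-(k+1)/2} 𝔼⁺[σ_a σ_{a₁}⋯σ_{a_k}] = [𝔼⁺[σ_aσ_{a₁}⋯] / 𝔼⁺[σ_cσ_{a₁}⋯]] ·
  [𝔼⁺[σ_cσ_{a₁}⋯σ_{a_k}] / (𝔼⁺[σ_c] 𝔼⁺[σ_{a₁}⋯σ_{a_k}])] · ϱ^{-1/2}𝔼⁺[σ_c] · ϱ^{-k/2}𝔼⁺[σ_{a₁}⋯σ_{a_k}]`;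
the first factor converges by Prop 2.20, the second is pinched in `[1, (1-η)⁻¹]` by GKS II and
Lemma 2.26, the last two converge by `T₀` and the induction hypothesis; the squeeze
`exists_pos_tendsto_of_squeeze` gives the limit. [cite: ChelkakHonglerIzyurovAnnals2015, §2.10, proof of Thm. 1.3] -/
theorem exists_pos_tendsto_rhoNormCorr_cons (hΩ : IsAdmissibleDomain Ω) (hM : MeshApproximates Ω)
    (h₁ : CHIOnePointLimits Ω) (hP : CHIRatioLimits Ω) (hL : CHIBoundaryDecorrelation Ω)
    {n : ℕ} {A : Fin (n + 1) → ℂ} (hA : Function.Injective A) (hAΩ : ∀ i, A i ∈ Ω)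
    (hIH : ∃ G : ℝ, 0 < G ∧ Tendsto (fun δ => rhoNormCorr Ω δ A) (𝓝[>] 0) (𝓝 G))
    {a : ℂ} (ha : a ∈ Ω) (haA : ∀ i, a ≠ A i) :
    ∃ G : ℝ, 0 < G ∧
      Tendsto (fun δ => rhoNormCorr Ω δ (Matrix.vecCons a A)) (𝓝[>] 0) (𝓝 G) := by
  obtain ⟨GA, hGA, hXA⟩ := hIH
  refine exists_pos_tendsto_of_squeeze fun η hη hη2 => ?_
  -- Lemma 2.26 for the marked points `A` and `η`
  obtain ⟨ε, hε, hLε⟩ := hL n A hA hAΩ η hη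
  -- an auxiliary point `c` near `∂Ω`, off `a` and the `A i`
  obtain ⟨c, hc, hcF, hcε⟩ :=
    exists_mem_notMem_infDist_lt hΩ ((Set.finite_range A).insert a) hε
  have hca : c ≠ a := fun h => hcF (by rw [h]; exact Set.mem_insert a _)
  have hcA : ∀ i, c ≠ A i := fun i h => hcF (Set.mem_insert_of_mem a ⟨i, h.symm⟩)
  -- the tuples `(a, A)` and `(c, A)` consist of distinct points of `Ω`
  have hinj_a : Function.Injective (Matrix.vecCons a A) :=
    Fin.cons_injective_iff.2 ⟨fun ⟨i, hi⟩ => haA i hi.symm, hA⟩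
  have hinj_c : Function.Injective (Matrix.vecCons c A) :=
    Fin.cons_injective_iff.2 ⟨fun ⟨i, hi⟩ => hcA i hi.symm, hA⟩
  have hmem_a : ∀ i, Matrix.vecCons a A i ∈ Ω := fun i => Fin.cases ha hAΩ i
  have hmem_c : ∀ i, Matrix.vecCons c A i ∈ Ω := fun i => Fin.cases hc hAΩ i
  -- Prop 2.20: `𝔼[σ_aσ_A] / 𝔼[σ_cσ_A] → r > 0`; `T₀` at `c`
  obtain ⟨r, hr, hR⟩ := hP (n + 1) (Matrix.vecCons c A) (Matrix.vecCons a A) hinj_c hinj_a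
    hmem_c hmem_a
  obtain ⟨G₁, hG₁, hX₁⟩ := h₁ c hc
  exact ⟨rhoNormComparison Ω a c A, r * G₁ * GA, by positivity,
    tendsto_rhoNormComparison hR hX₁ hXA,
    eventually_pinch_rhoNormCorr_cons hM hA hAΩ ha hc haA hcA hG₁ hGA (by linarith) hX₁ hXA
      (hLε c hc hcε)⟩

/-- **CHI Theorem 1.3, existence of the limits for all `k`, from `T₀`, Proposition 2.20 and
Lemma 2.26** (the induction `T₀ ⇒ T₁ ⇒ T₂ ⇒ ⋯` of §2.10, p. 20, run inside one admissible
domain whose discretisations approximate it): for all distinct `a₁, …, aₙ ∈ Ω` the normalised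
correlation `ϱ(δ)^{-n/2} 𝔼⁺_{Ω_δ}[σ_{a₁} ⋯ σ_{aₙ}]` has a positive limit as `δ → 0⁺`
(`n = 0`: the constant `1`; `n = 1`: `T₀`; `n + 1 ⇒ n + 2`: `exists_pos_tendsto_rhoNormCorr_cons`).
[cite: ChelkakHonglerIzyurovAnnals2015, §2.10, proof of Thm. 1.3] -/
theorem exists_pos_tendsto_rhoNormCorr (hΩ : IsAdmissibleDomain Ω) (hM : MeshApproximates Ω)
    (h₁ : CHIOnePointLimits Ω) (hP : CHIRatioLimits Ω) (hL : CHIBoundaryDecorrelation Ω) :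
    ∀ (n : ℕ) (a : Fin n → ℂ), Function.Injective a → (∀ i, a i ∈ Ω) →
      ∃ G : ℝ, 0 < G ∧ Tendsto (fun δ => rhoNormCorr Ω δ a) (𝓝[>] 0) (𝓝 G) := by
  intro n
  induction n with
  | zero =>
    intro a _ _
    refine ⟨1, one_pos, ?_⟩
    simp only [rhoNormCorr_def, meshIsingPlusCorr_fin_zero, Nat.cast_zero, neg_zero, zero_div,
      Real.rpow_zero, mul_one]
    exact tendsto_const_nhds
  | succ n ih =>
    intro a ha haΩ
    cases n with
    | zero =>
      obtain ⟨G, hG, h⟩ := h₁ (a 0) (haΩ 0)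
      refine ⟨G, hG, ?_⟩
      have hdecomp : a = ![a 0] := by
        ext i
        fin_cases i
        rfl
      rw [hdecomp]
      simpa [rhoNormCorr_def] using h
    | succ n =>
      have hdecomp : Matrix.vecCons (a 0) (Matrix.vecTail a) = a := Matrix.cons_head_tail a
      have htail : Function.Injective (Matrix.vecTail a) := fun i j h =>
        Fin.succ_injective _ (ha h)
      have htailΩ : ∀ i, Matrix.vecTail a i ∈ Ω := fun i => haΩ i.succ
      have h0 : ∀ i, a 0 ≠ Matrix.vecTail a i := fun i h => Fin.succ_ne_zero i (ha h).symm
      have key := exists_pos_tendsto_rhoNormCorr_cons hΩ hM h₁ hP hL htail htailΩ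
        (ih _ htail htailΩ) (haΩ 0) h0
      rwa [hdecomp] at key

end Convergence

end Literature.Probability.LatticeModels
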